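import Mathlib.Combinatorics.SimpleGraph.CycleGraph
import Literature.Probability.LatticeModels.HardCoreVacancyDecay
import HarnessLib

/-!
# Local surgery (finite energy) for the hard-core model: every admissible local pattern has conditional weight `≥ (2 max(λ, λ⁻¹))^{-|N[T]|}`

Setting and vocabulary: the hard-core model of the companion files `HardCoreSpatialMixing` /
`HardCoreVacancyDecay` — `hardCoreZ G λ Λ R = ∑ λ^{|I|}` over the independent sets `I` of the finite
graph `G` with `I ∩ Λ = R` (the vertices of `Λ` prescribed: `R` occupied, `Λ ∖ R` vacant)
[cite: Weitz2006, §2].  The hard-core specification has the FINITE-ENERGY property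
[cite: BurtonKeane1989, p. 501 (finite energy)] in the following uniform, quantitative form
("local surgery"): let `T` be a set of vertices whose closed neighbourhood
`N[T] = T ∪ ⋃_{t ∈ T} N(t)` (`closedNbhd`) avoids the prescribed region `Λ`, and let `τ ⊆ T` be ANY
independent set; the map `I ↦ (I ∖ N[T]) ∪ τ` (`surgery`) sends the independent sets with boundary
condition `(Λ, R)` to those with boundary condition `(Λ ∪ T, R ∪ τ)`, is at most `2^{|N[T]|}`-to-one
(the fibre is read off `I ∩ N[T]`), and changes the weight `λ^{|I|}` by at most `max(λ, λ⁻¹)^{|N[T]|}`.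
Hence (all PROVED; no named facts):

* `hardCoreZ_le_pow_mul_hardCoreZ_pattern` — for `λ > 0`,
  `hardCoreZ G λ Λ R ≤ (2·max(λ, λ⁻¹))^{|N[T]|} · hardCoreZ G λ (Λ ∪ T) (R ∪ τ)`,
  i.e. `P(I ∩ T = τ ∣ I ∩ Λ = R) ≥ (2 max(λ,λ⁻¹))^{-|N[T]|}` for EVERY independent `τ ⊆ T`
  ("hard-core Schwartz–Zippel": an event determined by `I ∩ T` that is satisfied by at least one
  independent pattern has conditional probability `≥ (2 max(λ,λ⁻¹))^{-|N[T]|}` —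
  `hardCoreZ_le_pow_mul_sum_event`);
* `card_closedNbhd_le` — `|N[T]| ≤ (Δ + 1)|T|` when all degrees are `≤ Δ`;
* `cycle_hardCoreZ_le_pow_mul_pattern` — the cycle `C_N = cycleGraph (n+3)` at fugacity `λ = 2`:
  `hardCoreZ C_N 2 Λ R ≤ 64^{|T|} · hardCoreZ C_N 2 (Λ ∪ T) (R ∪ τ)`.

Provenance / use: asked by the cell qa-qnc0 (planner qa-qnc0-p1 g34, ROUND-33 §4.7 / ask W-35d
"hard-core Schwartz–Zippel", 2026-08-29): the zero set ("coins") of the kernel line of a uniformly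
random odd input of the mod-3 ring game is hard-core distributed on `C_N` at fugacity `2`
(`KernelFibration.card_fibre`); an `O(log N)`-local function of the configuration that is not
identically constant on an outside-class therefore deviates from that constant on a `N^{-O(1)}`
fraction of the class.  The `x`-level statement (coins, forced bits, parity class) is Summits-side;
this file supplies the lattice-gas part in the tree's vocabulary.  The statements are elementary.

## References
* [BurtonKeane1989] R. M. Burton, M. Keane, *Density and uniqueness in percolation*, Comm. Math.
  Phys. 121 (1989) 501–505 — the finite-energy property (positivity of local modifications); the
  quantitative hard-core instance is supplied here.
* [Weitz2006] D. Weitz, *Counting independent sets up to the tree threshold*, STOC 2006, §2 — the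
  restricted partition function `Z^{Λ,R}` (vocabulary of `HardCoreSpatialMixing`).
-/

namespace Literature.Probability.LatticeModels

namespace HardCoreSurgery

open Finset HardCoreVacancy

variable {V : Type*} [Fintype V] [DecidableEq V] (G : SimpleGraph V) [DecidableRel G.Adj]

/-! ### The closed neighbourhood of a set -/

/-- The closed neighbourhood `N[T] = T ∪ ⋃_{t ∈ T} N(t)` of a set of vertices.
[cite: BurtonKeane1989, p. 501 (finite energy) — bookkeeping for the hard-core instance supplied here] -/
def closedNbhd (T : Finset V) : Finset V := T ∪ T.biUnion fun t => G.neighborFinset t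

/-- `T ⊆ N[T]`.
[cite: BurtonKeane1989, p. 501 — bookkeeping supplied here] -/
theorem subset_closedNbhd (T : Finset V) : T ⊆ closedNbhd G T := subset_union_left

/-- Neighbours of `T` lie in `N[T]`.
[cite: BurtonKeane1989, p. 501 — bookkeeping supplied here] -/
theorem mem_closedNbhd_of_adj {T : Finset V} {t w : V} (ht : t ∈ T) (hw : G.Adj t w) :
    w ∈ closedNbhd G T :=
  mem_union_right _ (mem_biUnion.2 ⟨t, ht, (G.mem_neighborFinset t w).2 hw⟩)

/-- `|N[T]| ≤ (Δ + 1)·|T|` when every vertex of `T` has degree `≤ Δ`.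
[cite: BurtonKeane1989, p. 501 — bookkeeping supplied here] -/
theorem card_closedNbhd_le {Δ : ℕ} (T : Finset V) (hΔ : ∀ t ∈ T, G.degree t ≤ Δ) :
    (closedNbhd G T).card ≤ (Δ + 1) * T.card := by
  unfold closedNbhd
  calc (T ∪ T.biUnion fun t => G.neighborFinset t).card
      ≤ T.card + (T.biUnion fun t => G.neighborFinset t).card := card_union_le _ _
    _ ≤ T.card + ∑ t ∈ T, (G.neighborFinset t).card := Nat.add_le_add_left card_biUnion_le _
    _ ≤ T.card + ∑ _t ∈ T, Δ := by
        refine Nat.add_le_add_left (sum_le_sum fun t ht => ?_) _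
        rw [SimpleGraph.card_neighborFinset_eq_degree]
        exact hΔ t ht
    _ = (Δ + 1) * T.card := by rw [sum_const, smul_eq_mul]; ring

/-! ### The surgery map -/

/-- Local surgery: clear the closed neighbourhood of `T` and paste the pattern `τ`.
[cite: BurtonKeane1989, p. 501 (finite energy: local modification) — hard-core instance supplied here] -/
def surgery (T τ I : Finset V) : Finset V := (I \ closedNbhd G T) ∪ τ

/-- Surgery produces an independent set (for `τ ⊆ T` independent).
[cite: BurtonKeane1989, p. 501 — hard-core instance supplied here] -/
theorem surgery_isIndepSet {T τ I : Finset V} (hI : G.IsIndepSet (I : Set V))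
    (hτ : G.IsIndepSet (τ : Set V)) (hτT : τ ⊆ T) :
    G.IsIndepSet (surgery G T τ I : Set V) := by
  intro a ha b hb hab
  rw [mem_coe, surgery, mem_union] at ha hb
  rcases ha with ha | ha <;> rcases hb with hb | hb
  · exact hI (mem_sdiff.1 ha).1 (mem_sdiff.1 hb).1 hab
  · -- `a ∈ I ∖ N[T]`, `b ∈ τ ⊆ T`: adjacency would put `a ∈ N[T]`
    intro hadj
    exact (mem_sdiff.1 ha).2 (mem_closedNbhd_of_adj G (hτT hb) hadj.symm)
  · intro hadj
    exact (mem_sdiff.1 hb).2 (mem_closedNbhd_of_adj G (hτT ha) hadj)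
  · exact hτ ha hb hab

/-- Surgery fixes the boundary condition and installs the pattern:
`surgery I ∩ (Λ ∪ T) = R ∪ τ` when `I ∩ Λ = R`, `τ ⊆ T` and `N[T] ∩ Λ = ∅`.
[cite: BurtonKeane1989, p. 501 — hard-core instance supplied here] -/
theorem surgery_inter_eq {Λ R T τ I : Finset V} (hIR : I ∩ Λ = R) (hτT : τ ⊆ T)
    (hN : Disjoint (closedNbhd G T) Λ) : surgery G T τ I ∩ (Λ ∪ T) = R ∪ τ := by
  have hTN := subset_closedNbhd G T
  ext a
  simp only [surgery, mem_inter, mem_union, mem_sdiff]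
  constructor
  · rintro ⟨(⟨haI, haN⟩ | haτ), (haΛ | haT)⟩
    · left; rw [← hIR]; exact mem_inter.2 ⟨haI, haΛ⟩
    · exact absurd (hTN haT) haN
    · right; exact haτ
    · right; exact haτ
  · rintro (haR | haτ)
    · have haI : a ∈ I := (mem_inter.1 (hIR ▸ haR : a ∈ I ∩ Λ)).1
      have haΛ : a ∈ Λ := (mem_inter.1 (hIR ▸ haR : a ∈ I ∩ Λ)).2
      exact ⟨Or.inl ⟨haI, fun haN => disjoint_left.1 hN haN haΛ⟩, Or.inl haΛ⟩
    · exact ⟨Or.inr haτ, Or.inr (hτT haτ)⟩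

/-- Off the closed neighbourhood, surgery changes nothing: `surgery I ∖ N[T] = I ∖ N[T]` (`τ ⊆ T`).
[cite: BurtonKeane1989, p. 501 — hard-core instance supplied here] -/
theorem surgery_sdiff_eq {T τ I : Finset V} (hτT : τ ⊆ T) :
    surgery G T τ I \ closedNbhd G T = I \ closedNbhd G T := by
  have hTN := subset_closedNbhd G T
  ext a
  simp only [surgery, mem_sdiff, mem_union]
  constructor
  · rintro ⟨(⟨haI, _⟩ | haτ), haN⟩
    · exact ⟨haI, haN⟩
    · exact absurd (hTN (hτT haτ)) haN
  · rintro ⟨haI, haN⟩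
    exact ⟨Or.inl ⟨haI, haN⟩, haN⟩

/-- The weight changes by at most `max(λ, λ⁻¹)^{|N[T]|}`: `λ^{|I|} ≤ max(λ,λ⁻¹)^{|N[T]|}·λ^{|surgery I|}`.
[cite: BurtonKeane1989, p. 501 — hard-core instance supplied here] -/
theorem pow_card_le_pow_mul_pow_card_surgery {lam : ℝ} (hlam : 0 < lam) {T τ I : Finset V}
    (hτT : τ ⊆ T) :
    lam ^ I.card ≤ (max lam lam⁻¹) ^ (closedNbhd G T).card * lam ^ (surgery G T τ I).card := by
  set N := closedNbhd G T with hN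
  set M := max lam lam⁻¹ with hM
  have hTN : τ ⊆ N := hτT.trans (subset_closedNbhd G T)
  -- `|I| = |I ∖ N| + |I ∩ N|`, `|surgery I| = |I ∖ N| + |τ|` (disjoint union)
  have hI : I.card = (I \ N).card + (I ∩ N).card := by
    rw [add_comm, card_inter_add_card_sdiff]
  have hS : (surgery G T τ I).card = (I \ N).card + τ.card := by
    rw [surgery, card_union_of_disjoint]
    exact disjoint_left.2 fun a ha haτ => (mem_sdiff.1 ha).2 (hTN haτ)
  have ha : (I ∩ N).card ≤ N.card := card_le_card inter_subset_right
  have hb : τ.card ≤ N.card := card_le_card hTN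
  rw [hI, hS, pow_add, pow_add, mul_left_comm]
  refine mul_le_mul_of_nonneg_left ?_ (pow_nonneg hlam.le _)
  -- `λ^a ≤ M^n · λ^b` for `a, b ≤ n`
  have hM1 : 1 ≤ M := by
    rcases le_or_gt 1 lam with h | h
    · exact h.trans (le_max_left _ _)
    · exact (one_le_inv₀ hlam |>.2 h.le).trans (le_max_right _ _)
  rcases le_or_gt 1 lam with h1 | h1
  · -- `λ ≥ 1`: `λ^a ≤ λ^n ≤ M^n ≤ M^n λ^b`
    calc lam ^ (I ∩ N).card ≤ lam ^ N.card := pow_le_pow_right₀ h1 ha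
      _ ≤ M ^ N.card := pow_le_pow_left₀ hlam.le (le_max_left _ _) _
      _ ≤ M ^ N.card * lam ^ τ.card :=
          le_mul_of_one_le_right (pow_nonneg (hlam.le.trans (le_max_left _ _)) _) (one_le_pow₀ h1)
  · -- `λ < 1`: `λ^a ≤ 1 ≤ λ^{-n} λ^b ≤ M^n λ^b`
    have hτn : lam ^ N.card ≤ lam ^ τ.card := pow_le_pow_of_le_one hlam.le h1.le hb
    calc lam ^ (I ∩ N).card ≤ 1 := pow_le_one₀ hlam.le h1.le
      _ ≤ (lam⁻¹) ^ N.card * lam ^ τ.card := by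
          rw [inv_pow]
          rw [le_inv_mul_iff₀ (pow_pos hlam _), mul_one]
          exact hτn
      _ ≤ M ^ N.card * lam ^ τ.card :=
          mul_le_mul_of_nonneg_right (pow_le_pow_left₀ (inv_pos.2 hlam).le (le_max_right _ _) _)
            (pow_nonneg hlam.le _)

/-! ### The local-surgery (finite-energy) bound -/

/-- **Local surgery / finite energy for the hard-core gas.**  For `λ > 0`, a set `T` whose closed
neighbourhood avoids the prescribed region `Λ`, and ANY independent pattern `τ ⊆ T`:
`Z^{Λ,R} ≤ (2·max(λ,λ⁻¹))^{|N[T]|} · Z^{Λ ∪ T, R ∪ τ}`, i.e. conditionally on the configuration on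
`Λ`, the pattern `τ` appears on `T` with probability at least `(2 max(λ,λ⁻¹))^{-|N[T]|}`.
Proof: `I ↦ (I ∖ N[T]) ∪ τ` is `≤ 2^{|N[T]|}`-to-one into the target ensemble and distorts weights by
`≤ max(λ,λ⁻¹)^{|N[T]|}`.
[cite: BurtonKeane1989, p. 501 (finite energy) — quantitative hard-core instance supplied here] -/
theorem hardCoreZ_le_pow_mul_hardCoreZ_pattern {lam : ℝ} (hlam : 0 < lam) {Λ R T τ : Finset V}
    (hN : Disjoint (closedNbhd G T) Λ) (hτT : τ ⊆ T) (hτ : G.IsIndepSet (τ : Set V)) :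
    hardCoreZ G lam Λ R
      ≤ (2 * max lam lam⁻¹) ^ (closedNbhd G T).card * hardCoreZ G lam (Λ ∪ T) (R ∪ τ) := by
  classical
  set N := closedNbhd G T with hNdef
  set M := max lam lam⁻¹ with hM
  set A := univ.filter (fun I : Finset V => G.IsIndepSet (I : Set V) ∧ I ∩ Λ = R) with hA
  set B := univ.filter (fun J : Finset V => G.IsIndepSet (J : Set V) ∧ J ∩ (Λ ∪ T) = R ∪ τ) with hB
  let Φ : Finset V → Finset V := surgery G T τ
  have hmaps : ∀ I ∈ A, Φ I ∈ B := by
    intro I hI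
    rw [hA, mem_filter] at hI
    rw [hB, mem_filter]
    exact ⟨mem_univ _, surgery_isIndepSet G hI.2.1 hτ hτT, surgery_inter_eq G hI.2.2 hτT hN⟩
  -- fibres of `Φ` have at most `2^{|N|}` elements: `I` is determined by `I ∩ N`
  have hfib : ∀ J ∈ B, ((A.filter fun I => Φ I = J).card : ℝ) ≤ (2 : ℝ) ^ N.card := by
    intro J _
    have h : (A.filter fun I => Φ I = J).card ≤ N.powerset.card := by
      refine card_le_card_of_injOn (fun I => I ∩ N) (fun I _ => ?_) ?_
      · rw [mem_coe, mem_powerset]; exact inter_subset_right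
      · intro I hI I' hI' hII'
        rw [mem_coe, mem_filter] at hI hI'
        have h1 : I \ N = I' \ N := by
          rw [← surgery_sdiff_eq G hτT (I := I), ← surgery_sdiff_eq G hτT (I := I')]
          show Φ I \ N = Φ I' \ N
          rw [hI.2, hI'.2]
        have h2 : I ∩ N = I' ∩ N := hII'
        rw [← sdiff_union_inter I N, ← sdiff_union_inter I' N, h1, h2]
    rw [card_powerset] at h
    exact_mod_cast h
  have hMnn : 0 ≤ M := hlam.le.trans (le_max_left _ _)
  calc hardCoreZ G lam Λ R = ∑ I ∈ A, lam ^ I.card := by rw [hardCoreZ_eq_sum_filter, ← hA]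
    _ ≤ ∑ I ∈ A, M ^ N.card * lam ^ (Φ I).card :=
        sum_le_sum fun I _ => pow_card_le_pow_mul_pow_card_surgery G hlam hτT
    _ = M ^ N.card * ∑ I ∈ A, lam ^ (Φ I).card := by rw [mul_sum]
    _ = M ^ N.card * ∑ J ∈ B, ∑ I ∈ A.filter (fun I => Φ I = J), lam ^ (Φ I).card := by
        rw [sum_fiberwise_of_maps_to hmaps]
    _ = M ^ N.card * ∑ J ∈ B, ((A.filter fun I => Φ I = J).card : ℝ) * lam ^ J.card := by
        congr 1
        refine sum_congr rfl fun J _ => ?_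
        rw [sum_congr rfl fun I hI => by rw [(mem_filter.1 hI).2], sum_const, nsmul_eq_mul]
    _ ≤ M ^ N.card * ∑ J ∈ B, (2 : ℝ) ^ N.card * lam ^ J.card := by
        refine mul_le_mul_of_nonneg_left (sum_le_sum fun J hJ => ?_) (pow_nonneg hMnn _)
        exact mul_le_mul_of_nonneg_right (hfib J hJ) (pow_nonneg hlam.le _)
    _ = (2 * M) ^ N.card * hardCoreZ G lam (Λ ∪ T) (R ∪ τ) := by
        rw [← mul_sum, ← mul_assoc, mul_pow, mul_comm (M ^ N.card), hardCoreZ_eq_sum_filter, ← hB]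

/-- The target ensemble lies inside "boundary `(Λ, R)` and pattern `τ` on `T`" (for `R ⊆ Λ`,
`τ ⊆ T`, `N[T] ∩ Λ = ∅`), so the bound can be read with `I ∩ Λ = R ∧ I ∩ T = τ`.
[cite: BurtonKeane1989, p. 501 — hard-core instance supplied here] -/
theorem hardCoreZ_le_pow_mul_sum_pattern {lam : ℝ} (hlam : 0 < lam) {Λ R T τ : Finset V}
    (hR : R ⊆ Λ) (hN : Disjoint (closedNbhd G T) Λ) (hτT : τ ⊆ T) (hτ : G.IsIndepSet (τ : Set V)) :
    hardCoreZ G lam Λ R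
      ≤ (2 * max lam lam⁻¹) ^ (closedNbhd G T).card *
          ∑ I ∈ univ.filter (fun I : Finset V => G.IsIndepSet (I : Set V) ∧ I ∩ Λ = R ∧ I ∩ T = τ),
            lam ^ I.card := by
  classical
  have hTΛ : Disjoint T Λ := disjoint_of_subset_left (subset_closedNbhd G T) hN
  refine (hardCoreZ_le_pow_mul_hardCoreZ_pattern G hlam hN hτT hτ).trans ?_
  refine mul_le_mul_of_nonneg_left ?_ (pow_nonneg (by positivity) _)
  rw [hardCoreZ_eq_sum_filter]
  refine sum_le_sum_of_subset_of_nonneg (fun I hI => ?_) fun I _ _ => pow_nonneg hlam.le _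
  rw [mem_filter] at hI ⊢
  obtain ⟨-, hind, hIΛT⟩ := hI
  refine ⟨mem_univ _, hind, ?_, ?_⟩
  · -- `I ∩ Λ = (I ∩ (Λ ∪ T)) ∩ Λ = (R ∪ τ) ∩ Λ = R`
    have h : I ∩ Λ = (I ∩ (Λ ∪ T)) ∩ Λ := by
      rw [inter_assoc, union_inter_cancel_left]
    rw [h, hIΛT, union_inter_distrib_right, inter_eq_left.2 hR]
    rw [disjoint_iff_inter_eq_empty.1 (disjoint_of_subset_left hτT hTΛ), union_empty]
  · have h : I ∩ T = (I ∩ (Λ ∪ T)) ∩ T := by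
      rw [inter_assoc, union_inter_cancel_right]
    rw [h, hIΛT, union_inter_distrib_right, inter_eq_left.2 hτT]
    rw [disjoint_iff_inter_eq_empty.1 (disjoint_of_subset_left hR hTΛ.symm), empty_union]

/-- **Hard-core Schwartz–Zippel (event form).**  If an event `E` on patterns is satisfied by at least
one independent pattern `τ ⊆ T`, then the configurations whose restriction to `T` satisfies `E` carry
at least a `(2 max(λ,λ⁻¹))^{-|N[T]|}` fraction of `Z^{Λ,R}` (for `R ⊆ Λ`, `N[T] ∩ Λ = ∅`).
[cite: BurtonKeane1989, p. 501 (finite energy) — quantitative hard-core instance supplied here] -/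
theorem hardCoreZ_le_pow_mul_sum_event {lam : ℝ} (hlam : 0 < lam) {Λ R T : Finset V}
    (hR : R ⊆ Λ) (hN : Disjoint (closedNbhd G T) Λ) (E : Finset V → Prop) [DecidablePred E]
    (hE : ∃ τ, τ ⊆ T ∧ G.IsIndepSet (τ : Set V) ∧ E τ) :
    hardCoreZ G lam Λ R
      ≤ (2 * max lam lam⁻¹) ^ (closedNbhd G T).card *
          ∑ I ∈ univ.filter (fun I : Finset V => G.IsIndepSet (I : Set V) ∧ I ∩ Λ = R ∧ E (I ∩ T)),
            lam ^ I.card := by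
  classical
  obtain ⟨τ, hτT, hτ, hEτ⟩ := hE
  refine (hardCoreZ_le_pow_mul_sum_pattern G hlam hR hN hτT hτ).trans ?_
  refine mul_le_mul_of_nonneg_left ?_ (pow_nonneg (by positivity) _)
  refine sum_le_sum_of_subset_of_nonneg (fun I hI => ?_) fun I _ _ => pow_nonneg hlam.le _
  rw [mem_filter] at hI ⊢
  exact ⟨hI.1, hI.2.1, hI.2.2.1, hI.2.2.2.symm ▸ hEτ⟩

/-- Degree form of the constant: if all vertices of `T` have degree `≤ Δ`, the factor is at most
`(2 max(λ,λ⁻¹))^{(Δ+1)|T|}`.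
[cite: BurtonKeane1989, p. 501 — hard-core instance supplied here] -/
theorem hardCoreZ_le_pow_mul_hardCoreZ_pattern_of_degree {lam : ℝ} (hlam : 0 < lam) {Δ : ℕ}
    {Λ R T τ : Finset V} (hΔ : ∀ t ∈ T, G.degree t ≤ Δ) (hN : Disjoint (closedNbhd G T) Λ)
    (hτT : τ ⊆ T) (hτ : G.IsIndepSet (τ : Set V)) :
    hardCoreZ G lam Λ R
      ≤ (2 * max lam lam⁻¹) ^ ((Δ + 1) * T.card) * hardCoreZ G lam (Λ ∪ T) (R ∪ τ) := by
  refine (hardCoreZ_le_pow_mul_hardCoreZ_pattern G hlam hN hτT hτ).trans ?_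
  have h1 : (1 : ℝ) ≤ 2 * max lam lam⁻¹ := by
    rcases le_or_gt 1 lam with h | h
    · nlinarith [le_max_left lam lam⁻¹]
    · have : 1 ≤ lam⁻¹ := (one_le_inv₀ hlam).2 h.le
      nlinarith [le_max_right lam lam⁻¹]
  exact mul_le_mul_of_nonneg_right (pow_le_pow_right₀ h1 (card_closedNbhd_le G T hΔ))
    (hardCoreZ_nonneg G hlam.le _ _)

/-- **The cycle at fugacity `2`** (the law of the coin set of the mod-3 ring game): for `N ≥ 3`,
every set `T` of ring positions with `N[T] ∩ Λ = ∅` and every independent `τ ⊆ T`,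
`Z^{Λ,R} ≤ 64^{|T|} · Z^{Λ ∪ T, R ∪ τ}`  (`|N[T]| ≤ 3|T|`, `2·max(2, ½) = 4`, `4³ = 64`).
[cite: BurtonKeane1989, p. 501 (finite energy) — cycle/fugacity-2 instance supplied here] -/
theorem cycle_hardCoreZ_le_pow_mul_pattern (n : ℕ) {Λ R T τ : Finset (Fin (n + 3))}
    (hN : Disjoint (closedNbhd (SimpleGraph.cycleGraph (n + 3)) T) Λ) (hτT : τ ⊆ T)
    (hτ : (SimpleGraph.cycleGraph (n + 3)).IsIndepSet (τ : Set (Fin (n + 3)))) :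
    hardCoreZ (SimpleGraph.cycleGraph (n + 3)) 2 Λ R
      ≤ (64 : ℝ) ^ T.card * hardCoreZ (SimpleGraph.cycleGraph (n + 3)) 2 (Λ ∪ T) (R ∪ τ) := by
  have h := hardCoreZ_le_pow_mul_hardCoreZ_pattern_of_degree (SimpleGraph.cycleGraph (n + 3))
    (lam := 2) (by norm_num) (Δ := 2) (R := R)
    (fun t _ => (SimpleGraph.cycleGraph_degree_three_le (v := t)).le) hN hτT hτ
  have hmax : max (2 : ℝ) 2⁻¹ = 2 := max_eq_left (by norm_num)
  rw [hmax, show (2 : ℝ) * 2 = 4 by norm_num, pow_mul, show (4 : ℝ) ^ (2 + 1) = 64 by norm_num] at h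
  exact h

end HardCoreSurgery

end Literature.Probability.LatticeModels
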